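import Mathlib.Algebra.Lie.Sl2
import Mathlib.Algebra.Lie.OfAssociative
import Mathlib.LinearAlgebra.Eigenspace.Triangularizable
import Mathlib.LinearAlgebra.Eigenspace.Minpoly
import Mathlib.LinearAlgebra.Eigenspace.Pi
import Mathlib.Algebra.DirectSum.Module
import HarnessLib

/-!
# The string basis of a finite-dimensional `sl₂`-module (complete reducibility, explicit form)

General Lie theory (namespace `Literature.Sl2`), needed for the construction of reductive groups from
Lie algebras (Springer, *Linear Algebraic Groups*, 2nd ed., 10.1–10.2; Chevalley's existence
theorem, `Literature.NumberTheory.Automorphic.chevalley_existence`): the homomorphisms `SL₂ → G` realising a root are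
obtained by exponentiating an `sl₂`-triple of matrices string by string, which requires the
classical structure theorem for finite-dimensional `sl₂`-modules in characteristic `0`
(Serre, *Complex Semisimple Lie Algebras*, IV.3, Thm 2–3; Humphreys, *Introduction to Lie
Algebras*, §7.2 with Weyl's theorem 6.3 for `sl₂`; Bourbaki LIE VIII §1). Mathlib has
`IsSl2Triple`, primitive vectors (`IsSl2Triple.HasPrimitiveVectorWith`) and the facts that the
weight of a primitive vector in a Noetherian module is a natural number `m` (`exists_nat`) and
that its string `v, F v, …, F^m v` is non-zero with `F^{m+1} v = 0`, but no complete
reducibility. This file proves it, in the explicit form of a **string basis**, for a triple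
`(H, E, F)` of endomorphisms of a finite-dimensional vector space `V` over an algebraically closed
field of characteristic `0` such that `H` is diagonalisable (`⨆ μ, V_μ = V`; in the intended
application `H` is a toral element acting diagonally):

* relations and weight shifts (`rel_HE`, `apply_E_mem`, …); the bridge to Mathlib's primitive
  vectors for the triple inside the Lie algebra `End V` (`hasPrimitiveVectorWith`,
  `exists_nat_of_primitive`, `F_pow_succ_apply_eq_zero`, `F_pow_apply_ne_zero`);
* the **Casimir operator** `C = 4 F E + H² + 2 H` (`casimir`): it acts by `μ² + 2μ` on primitive
  vectors of weight `μ` and commutes with `E`, `F`, `H` (checked on weight vectors);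
* **iterating `E` reaches a primitive vector** (`exists_E_pow_primitive`, finitely many weights);
* the **Casimir blocks** `V(c)` (generalised eigenspaces of `C`, stable under the triple): since
  `m ↦ m (m + 2)` is injective on `ℕ`, *all primitive vectors of `V(c)` have the same weight `m`*
  (`weight_eq_of_primitive`), so `E` is injective on `V(c) ∩ V_μ` for `μ ≠ m`; with the symmetric
  triple `(-H, F, E)` (same Casimir) for lowest weights, the weights of `V(c)` are exactly the
  `m - 2j`, `j ≤ m` (`exists_weight_eq`), `V(c) ∩ V_m` consists of primitive vectors, and
  `F^j : V(c) ∩ V_m → V(c) ∩ V_{m-2j}` is injective for `j ≤ m` with injective `E^j` back, hence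
  bijective (`finrank_piece_eq`, `exists_F_pow_eq`), and `V(c) = ⨆_{j ≤ m} V(c) ∩ V_{m-2j}`
  (`block_eq_iSup_piece`);
* the **simultaneous decomposition** `V = ⊕_{(c, μ)} V(c) ∩ V_μ` under the commuting pair `(C, H)`
  (Mathlib's simultaneous generalised eigenspaces; `maxGenEigenspace_eq_wsp` for the
  diagonalisable `H`; `isInternal_simPiece`);
* the **string basis** `stringBasis t hdiag : Basis (Σ χ, Fin d_χ) k V` collected from the bases
  `F^j (w_s)` of the non-zero pieces `χ = (c, m - 2j)`, where `(w_s)` is a basis of the top piece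
  `V(c) ∩ V_m` (`topBasis`, primitive vectors of weight `m = natOf c`, `topBasis_primitive`) and
  `j = posOf χ` (`stringBasis_apply`); every position `j ≤ m` of a non-zero block occurs
  (`simPiece_ne_bot_of_le`, `posOf_eq`).

In words: `V` is the direct sum of the strings `w_s, F w_s, …, F^m w_s` generated by a basis of
primitive vectors — complete reducibility of `V` into simple modules `V(m)`, with an explicit
basis adapted to it.

## Mathlib

`IsSl2Triple`, `IsSl2Triple.HasPrimitiveVectorWith.exists_nat`, `.pow_toEnd_f_eq_zero_of_eq_nat`,
`.pow_toEnd_f_ne_zero_of_eq_nat` (`Mathlib/Algebra/Lie/Sl2.lean`), the Lie structure of `End V`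
(`LieRing.ofAssociativeRing`, a local instance as in Mathlib), `Module.End.maxGenEigenspace`,
`independent_maxGenEigenspace`, `iSup_maxGenEigenspace_eq_top`,
`iSup_iInf_maxGenEigenspace_eq_top_of_iSup_maxGenEigenspace_eq_top_of_commute`,
`independent_iInf_maxGenEigenspace_of_forall_mapsTo`, `Submodule.inf_iSup_genEigenspace`,
`Module.End.finite_hasEigenvalue`, `DirectSum.IsInternal.collectedBasis`,
`iSupIndep.fintypeNeBotOfFiniteDimensional`. Mathlib has no complete reducibility for `sl₂`
(nor Weyl's theorem, nor a Casimir element of a Lie module: `lean search` for `Casimir`,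
`complete reducib` gives no Mathlib hits; `IsSl2Triple` material stops at primitive strings);
nothing here duplicates a Mathlib declaration. The tree's `Literature/Algebra/Lie/` has PBW
(`PoincareBirkhoffWitt.lean`), unrelated to this file's elementary route.

## References

* J.-P. Serre, *Complex Semisimple Lie Algebras*, Springer (1987/2001), Ch. IV, Thm 2, Thm 3,
  Cor. 1–3.
* J. E. Humphreys, *Introduction to Lie Algebras and Representation Theory*, GTM 9, Springer
  (1972), §6.3 (Weyl's theorem), §7.2 (classification of `sl₂`-modules).
* T. A. Springer, *Linear Algebraic Groups*, 2nd ed. (1998), 10.1.1, 10.2 [SpringerLAG1998].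
-/

noncomputable section

namespace Literature.Algebra.Lie.Sl2

open Module LieModule

attribute [local instance 100] LieRing.ofAssociativeRing

variable {k : Type*} [Field k]
variable {V : Type*} [AddCommGroup V] [Module k V]
variable {H E F : Module.End k V}

/-- The weight space `V_μ` of `H`. [folklore] -/
abbrev wsp (H : Module.End k V) (μ : k) : Submodule k V := H.eigenspace μ

/-- Membership in a weight space. [folklore] -/
lemma mem_wsp_iff {μ : k} {v : V} : v ∈ wsp H μ ↔ H v = μ • v := Module.End.mem_eigenspace_iff

/-- `toEnd` of the tautological `End V`-module is the identity. [folklore] -/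
lemma toEnd_eq (A : Module.End k V) : LieModule.toEnd k (Module.End k V) V A = A :=
  LinearMap.ext fun _ => rfl

/-- Powers under `toEnd` of the tautological module. [folklore] -/
lemma toEnd_pow_apply (A : Module.End k V) (j : ℕ) (v : V) :
    ((LieModule.toEnd k (Module.End k V) V A) ^ j) v = (A ^ j) v := by
  rw [toEnd_eq]

section Relations

variable (t : IsSl2Triple H E F)
include t

/-- `H E = E H + 2 E`. [folklore] -/
lemma rel_HE : H * E = E * H + 2 • E := by
  have h := t.lie_h_e_nsmul
  rw [LieRing.of_associative_ring_bracket, sub_eq_iff_eq_add] at h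
  rw [h, add_comm]

/-- `H F = F H - 2 F`. [folklore] -/
lemma rel_HF : H * F = F * H - 2 • F := by
  have h := t.lie_h_f_nsmul
  rw [LieRing.of_associative_ring_bracket, sub_eq_iff_eq_add] at h
  rw [h]
  abel

/-- `E F = F E + H`. [folklore] -/
lemma rel_EF : E * F = F * E + H := by
  have h := t.lie_e_f
  rw [LieRing.of_associative_ring_bracket, sub_eq_iff_eq_add] at h
  rw [h, add_comm]

/-- `E` raises weights by `2`. [folklore] -/
lemma apply_E_mem {μ : k} {v : V} (hv : v ∈ wsp H μ) : E v ∈ wsp H (μ + 2) := by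
  rw [mem_wsp_iff] at hv ⊢
  have h := LinearMap.congr_fun (rel_HE t) v
  simp only [Module.End.mul_apply, LinearMap.add_apply, LinearMap.smul_apply, hv, map_smul] at h
  rw [h, add_smul, two_smul, two_smul]

/-- `F` lowers weights by `2`. [folklore] -/
lemma apply_F_mem {μ : k} {v : V} (hv : v ∈ wsp H μ) : F v ∈ wsp H (μ - 2) := by
  rw [mem_wsp_iff] at hv ⊢
  have h := LinearMap.congr_fun (rel_HF t) v
  simp only [Module.End.mul_apply, LinearMap.sub_apply, LinearMap.smul_apply, hv, map_smul] at h
  rw [h, sub_smul, two_smul, two_smul]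

/-- `E ^ j` raises weights by `2 j`. [folklore] -/
lemma apply_E_pow_mem {μ : k} {v : V} (hv : v ∈ wsp H μ) (j : ℕ) :
    (E ^ j) v ∈ wsp H (μ + 2 * j) := by
  induction j with
  | zero => simpa using hv
  | succ j ih =>
    rw [pow_succ', Module.End.mul_apply]
    have h := apply_E_mem t ih
    convert h using 2
    push_cast
    ring

/-- `F ^ j` lowers weights by `2 j`. [folklore] -/
lemma apply_F_pow_mem {μ : k} {v : V} (hv : v ∈ wsp H μ) (j : ℕ) :
    (F ^ j) v ∈ wsp H (μ - 2 * j) := by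
  induction j with
  | zero => simpa using hv
  | succ j ih =>
    rw [pow_succ', Module.End.mul_apply]
    have h := apply_F_mem t ih
    convert h using 2
    push_cast
    ring

/-! ### Primitive vectors: bridge to Mathlib's `IsSl2Triple.HasPrimitiveVectorWith` -/

/-- A non-zero `v ∈ V_μ` killed by `E` is a primitive vector in Mathlib's sense, for the
`sl₂`-triple inside the Lie algebra `End V`. [folklore] -/
lemma hasPrimitiveVectorWith {μ : k} {v : V} (hv : v ∈ wsp H μ) (hv0 : v ≠ 0) (hE : E v = 0) :
    t.HasPrimitiveVectorWith v μ where
  ne_zero := hv0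
  lie_h := by rw [Module.End.lie_apply]; exact mem_wsp_iff.mp hv
  lie_e := by rw [Module.End.lie_apply, hE]

variable [CharZero k] [FiniteDimensional k V]

/-- **The weight of a primitive vector is a natural number** (Mathlib
`IsSl2Triple.HasPrimitiveVectorWith.exists_nat`). [folklore] -/
lemma exists_nat_of_primitive {μ : k} {v : V} (hv : v ∈ wsp H μ) (hv0 : v ≠ 0) (hE : E v = 0) :
    ∃ m : ℕ, μ = m :=
  (hasPrimitiveVectorWith t hv hv0 hE).exists_nat

/-- `F ^ (m + 1) v = 0` for a primitive vector of weight `m`. [folklore] -/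
lemma F_pow_succ_apply_eq_zero {m : ℕ} {v : V} (hv : v ∈ wsp H (m : k)) (hv0 : v ≠ 0)
    (hE : E v = 0) : (F ^ (m + 1)) v = 0 := by
  rw [← toEnd_pow_apply]
  exact (hasPrimitiveVectorWith t hv hv0 hE).pow_toEnd_f_eq_zero_of_eq_nat rfl

omit [FiniteDimensional k V] in
/-- `F ^ j v ≠ 0` for `j ≤ m` and a primitive vector of weight `m`. [folklore] -/
lemma F_pow_apply_ne_zero {m : ℕ} {v : V} (hv : v ∈ wsp H (m : k)) (hv0 : v ≠ 0)
    (hE : E v = 0) {j : ℕ} (hj : j ≤ m) : (F ^ j) v ≠ 0 := by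
  rw [← toEnd_pow_apply]
  exact (hasPrimitiveVectorWith t hv hv0 hE).pow_toEnd_f_ne_zero_of_eq_nat rfl hj

end Relations

/-! ### The Casimir operator `C = 4 F E + H² + 2 H` -/

/-- The (rescaled) Casimir operator `C = 4 F E + H² + 2 H` of the triple. [folklore] -/
def casimir (H E F : Module.End k V) : Module.End k V := (4 : k) • (F * E) + H * H + (2 : k) • H

section Casimir

variable (t : IsSl2Triple H E F)
include t

omit t in
/-- `C v = 4 F E v + (μ² + 2μ) v` on `V_μ`. [folklore] -/
lemma casimir_apply_of_mem {μ : k} {v : V} (hv : v ∈ wsp H μ) :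
    casimir H E F v = (4 : k) • F (E v) + (μ * μ + 2 * μ) • v := by
  have hv' := mem_wsp_iff.mp hv
  simp only [casimir, LinearMap.add_apply, LinearMap.smul_apply, Module.End.mul_apply, hv',
    map_smul]
  module

omit t in
/-- `C v = (μ² + 2μ) v` for a primitive `v ∈ V_μ`. [folklore] -/
lemma casimir_apply_primitive {μ : k} {v : V} (hv : v ∈ wsp H μ) (hE : E v = 0) :
    casimir H E F v = (μ * μ + 2 * μ) • v := by
  rw [casimir_apply_of_mem hv, hE, map_zero, smul_zero, zero_add]

/-- `C` preserves weight spaces. [folklore] -/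
lemma casimir_apply_mem {μ : k} {v : V} (hv : v ∈ wsp H μ) : casimir H E F v ∈ wsp H μ := by
  rw [casimir_apply_of_mem hv]
  refine add_mem (Submodule.smul_mem _ _ ?_) (Submodule.smul_mem _ _ hv)
  have h := apply_F_mem t (apply_E_mem t hv)
  rwa [add_sub_cancel_right] at h

/-- `C E = E C` on weight vectors. [folklore] -/
lemma casimir_E_apply_of_mem {μ : k} {v : V} (hv : v ∈ wsp H μ) :
    casimir H E F (E v) = E (casimir H E F v) := by
  have hEF : ∀ w : V, E (F w) = F (E w) + H w := fun w => by
    have h := LinearMap.congr_fun (rel_EF t) w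
    simpa only [Module.End.mul_apply, LinearMap.add_apply] using h
  rw [casimir_apply_of_mem (apply_E_mem t hv), casimir_apply_of_mem hv, map_add,
    LinearMap.map_smul_of_tower, LinearMap.map_smul_of_tower, hEF,
    mem_wsp_iff.mp (apply_E_mem t hv)]
  module

/-- `C F = F C` on weight vectors. [folklore] -/
lemma casimir_F_apply_of_mem {μ : k} {v : V} (hv : v ∈ wsp H μ) :
    casimir H E F (F v) = F (casimir H E F v) := by
  have hEF : ∀ w : V, E (F w) = F (E w) + H w := fun w => by
    have h := LinearMap.congr_fun (rel_EF t) w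
    simpa only [Module.End.mul_apply, LinearMap.add_apply] using h
  rw [casimir_apply_of_mem (apply_F_mem t hv), casimir_apply_of_mem hv, map_add,
    LinearMap.map_smul_of_tower, LinearMap.map_smul_of_tower, hEF, mem_wsp_iff.mp hv, map_add,
    LinearMap.map_smul_of_tower]
  module

variable (hdiag : ⨆ μ : k, wsp H μ = ⊤)
include hdiag

omit t in
/-- Two endomorphisms agreeing on all weight vectors agree (`H` diagonalisable). [folklore] -/
lemma ext_of_wsp {A B : Module.End k V} (h : ∀ (μ : k), ∀ v ∈ wsp H μ, A v = B v) : A = B := by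
  refine LinearMap.ext fun v => ?_
  have hv : v ∈ ⨆ μ : k, wsp H μ := by rw [hdiag]; trivial
  refine Submodule.iSup_induction (motive := fun v => A v = B v) _ hv h (by simp) ?_
  intro x y hx hy
  rw [map_add, map_add, hx, hy]

/-- `C` commutes with `E`. [folklore] -/
lemma commute_casimir_E : Commute (casimir H E F) E :=
  ext_of_wsp hdiag fun _ _ hv => casimir_E_apply_of_mem t hv

/-- `C` commutes with `F`. [folklore] -/
lemma commute_casimir_F : Commute (casimir H E F) F :=
  ext_of_wsp hdiag fun _ _ hv => casimir_F_apply_of_mem t hv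

/-- `C` commutes with `H`. [folklore] -/
lemma commute_casimir_H : Commute (casimir H E F) H :=
  ext_of_wsp hdiag fun μ v hv => by
    change casimir H E F (H v) = H (casimir H E F v)
    rw [mem_wsp_iff.mp hv, LinearMap.map_smul_of_tower, mem_wsp_iff.mp (casimir_apply_mem t hv)]

end Casimir

/-! ### Primitive vectors above any weight vector; Casimir blocks -/

section Blocks

variable [CharZero k] [FiniteDimensional k V] (t : IsSl2Triple H E F)
include t

omit [CharZero k] t in
/-- Finitely many weights. [folklore] -/
lemma finite_weights : {μ : k | wsp H μ ≠ ⊥}.Finite :=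
  Module.End.finite_hasEigenvalue H

/-- **Iterating `E` from a weight vector reaches a primitive vector.** [folklore] -/
lemma exists_E_pow_primitive {μ : k} {v : V} (hv : v ∈ wsp H μ) (hv0 : v ≠ 0) :
    ∃ j : ℕ, (E ^ j) v ≠ 0 ∧ E ((E ^ j) v) = 0 := by
  classical
  have hex : ∃ j : ℕ, (E ^ j) v = 0 := by
    by_contra hne
    push Not at hne
    have hinj : Function.Injective (fun j : ℕ => μ + 2 * (j : k)) := by
      intro a b hab
      have h : (2 : k) * a = 2 * b := add_left_cancel hab
      exact_mod_cast (mul_right_injective₀ (two_ne_zero' k) h)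
    have hsub : Set.range (fun j : ℕ => μ + 2 * (j : k)) ⊆ {μ' : k | wsp H μ' ≠ ⊥} := by
      rintro _ ⟨j, rfl⟩
      exact (Submodule.ne_bot_iff _).mpr ⟨_, apply_E_pow_mem t hv j, hne j⟩
    exact (Set.infinite_range_of_injective hinj).mono hsub (finite_weights (H := H))
  obtain ⟨j₀, hj₀, hmin⟩ : ∃ j₀, (E ^ j₀) v = 0 ∧ ∀ j < j₀, (E ^ j) v ≠ 0 :=
    ⟨Nat.find hex, Nat.find_spec hex, fun j hj => Nat.find_min hex hj⟩
  obtain ⟨j, rfl⟩ : ∃ j, j₀ = j + 1 :=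
    Nat.exists_eq_succ_of_ne_zero (by rintro rfl; exact hv0 (by simpa using hj₀))
  refine ⟨j, hmin j (Nat.lt_succ_self j), ?_⟩
  rw [← Module.End.mul_apply, ← pow_succ']
  exact hj₀

/-- The Casimir block of `c`: the generalised eigenspace of `C`. [folklore] -/
abbrev block (H E F : Module.End k V) (c : k) : Submodule k V := (casimir H E F).maxGenEigenspace c

omit [CharZero k] [FiniteDimensional k V] t in
/-- On a primitive vector of a Casimir block the eigenvalue is `μ² + 2μ`. [folklore] -/
lemma casimir_scalar_eq_of_primitive {c μ : k} {v : V} (hvW : v ∈ block H E F c)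
    (hv : v ∈ wsp H μ) (hv0 : v ≠ 0) (hE : E v = 0) : μ * μ + 2 * μ = c := by
  obtain ⟨N, hN⟩ := (Module.End.mem_maxGenEigenspace _ _ _).mp hvW
  have hpow : ∀ N : ℕ, (((casimir H E F) - c • (1 : Module.End k V)) ^ N) v =
      ((μ * μ + 2 * μ - c) ^ N) • v := by
    intro N
    induction N with
    | zero => simp
    | succ N ih =>
      rw [pow_succ', Module.End.mul_apply, ih, LinearMap.map_smul_of_tower, LinearMap.sub_apply,
        LinearMap.smul_apply, Module.End.one_apply, casimir_apply_primitive hv hE, ← sub_smul,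
        smul_smul, ← pow_succ]
  rw [hpow] at hN
  have h := (smul_eq_zero.mp hN).resolve_right hv0
  exact sub_eq_zero.mp (pow_eq_zero_iff'.mp h).1

omit [FiniteDimensional k V] t in
/-- `m ↦ m (m + 2)` is injective on `ℕ` (in a field of characteristic `0`). [folklore] -/
lemma nat_eq_of_cast_mul_add_eq {m m' : ℕ}
    (h : (m : k) * m + 2 * m = (m' : k) * m' + 2 * m') : m = m' := by
  have h' : m * m + 2 * m = m' * m' + 2 * m' := by exact_mod_cast h
  nlinarith [h', Nat.zero_le m, Nat.zero_le m']

variable (hdiag : ⨆ μ : k, wsp H μ = ⊤)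
include hdiag

omit [CharZero k] [FiniteDimensional k V] in
/-- `E` preserves Casimir blocks. [folklore] -/
lemma apply_E_mem_block {c : k} {v : V} (hv : v ∈ block H E F c) : E v ∈ block H E F c :=
  Module.End.mapsTo_maxGenEigenspace_of_comm (commute_casimir_E t hdiag) c hv

omit [CharZero k] [FiniteDimensional k V] in
/-- `F` preserves Casimir blocks. [folklore] -/
lemma apply_F_mem_block {c : k} {v : V} (hv : v ∈ block H E F c) : F v ∈ block H E F c :=
  Module.End.mapsTo_maxGenEigenspace_of_comm (commute_casimir_F t hdiag) c hv

omit [CharZero k] [FiniteDimensional k V] in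
/-- `H` preserves Casimir blocks. [folklore] -/
lemma apply_H_mem_block {c : k} {v : V} (hv : v ∈ block H E F c) : H v ∈ block H E F c :=
  Module.End.mapsTo_maxGenEigenspace_of_comm (commute_casimir_H t hdiag) c hv

omit [CharZero k] [FiniteDimensional k V] in
/-- Powers of `E` preserve Casimir blocks. [folklore] -/
lemma apply_E_pow_mem_block {c : k} {v : V} (hv : v ∈ block H E F c) (j : ℕ) :
    (E ^ j) v ∈ block H E F c := by
  induction j with
  | zero => simpa using hv
  | succ j ih => rw [pow_succ', Module.End.mul_apply]; exact apply_E_mem_block t hdiag ih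

omit [CharZero k] [FiniteDimensional k V] in
/-- Powers of `F` preserve Casimir blocks. [folklore] -/
lemma apply_F_pow_mem_block {c : k} {v : V} (hv : v ∈ block H E F c) (j : ℕ) :
    (F ^ j) v ∈ block H E F c := by
  induction j with
  | zero => simpa using hv
  | succ j ih => rw [pow_succ', Module.End.mul_apply]; exact apply_F_mem_block t hdiag ih

variable {c : k} {m : ℕ} (hcm : (m : k) * m + 2 * m = c)
include hcm

omit hdiag in
/-- **All primitive vectors of a Casimir block have the same weight `m`**, where
`c = m (m + 2)`. [folklore] -/
lemma weight_eq_of_primitive {μ : k} {v : V} (hvW : v ∈ block H E F c) (hv : v ∈ wsp H μ)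
    (hv0 : v ≠ 0) (hE : E v = 0) : μ = m := by
  obtain ⟨m', rfl⟩ := exists_nat_of_primitive t hv hv0 hE
  have h := casimir_scalar_eq_of_primitive hvW hv hv0 hE
  rw [← hcm] at h
  rw [nat_eq_of_cast_mul_add_eq h]

omit hdiag in
/-- **`E` is injective on the weight spaces `V_μ`, `μ ≠ m`, of a Casimir block.** [folklore] -/
lemma eq_zero_of_E_eq_zero {μ : k} (hμ : μ ≠ m) {v : V} (hvW : v ∈ block H E F c)
    (hv : v ∈ wsp H μ) (hE : E v = 0) : v = 0 := by
  by_contra hv0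
  exact hμ (weight_eq_of_primitive t hcm hvW hv hv0 hE)

/-- **The weights of a Casimir block are `≤ m` and `≡ m (mod 2)`**: a non-zero `v ∈ V_μ` in the
block has `μ = m - 2 j` for some `j`. [folklore] -/
lemma exists_weight_eq_sub {μ : k} {v : V} (hvW : v ∈ block H E F c) (hv : v ∈ wsp H μ)
    (hv0 : v ≠ 0) : ∃ j : ℕ, μ = m - 2 * j := by
  obtain ⟨j, hj0, hjE⟩ := exists_E_pow_primitive t hv hv0
  refine ⟨j, ?_⟩
  have h := weight_eq_of_primitive t hcm (apply_E_pow_mem_block t hdiag hvW j)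
    (apply_E_pow_mem t hv j) hj0 hjE
  rw [← h]
  ring

end Blocks

/-! ### The symmetric triple and lowest weights; the weights of a block -/

section Symmetric

/-- Weight spaces of `-H`. [folklore] -/
lemma mem_wsp_neg_iff {ν : k} {v : V} : v ∈ wsp (-H) ν ↔ v ∈ wsp H (-ν) := by
  rw [mem_wsp_iff, mem_wsp_iff, LinearMap.neg_apply, neg_eq_iff_eq_neg, neg_smul]

/-- The Casimir operator of the symmetric triple `(-H, F, E)` is the same. [folklore] -/
lemma casimir_symm (t : IsSl2Triple H E F) : casimir (-H) F E = casimir H E F := by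
  rw [casimir, casimir, rel_EF t, neg_mul_neg, smul_add, smul_neg]
  module

/-- `-H` is diagonalisable if `H` is. [folklore] -/
lemma hdiag_neg (hdiag : ⨆ μ : k, wsp H μ = ⊤) : ⨆ ν : k, wsp (-H) ν = ⊤ := by
  rw [eq_top_iff, ← hdiag]
  refine iSup_le fun μ => le_iSup_of_le (-μ) ?_
  intro v hv
  rw [mem_wsp_neg_iff, neg_neg]
  exact hv

variable [CharZero k] [FiniteDimensional k V] (t : IsSl2Triple H E F)
  (hdiag : ⨆ μ : k, wsp H μ = ⊤) {c : k} {m : ℕ} (hcm : (m : k) * m + 2 * m = c)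
include t hdiag hcm

/-- **The weights of a Casimir block are `≥ -m` and `≡ m (mod 2)`** (lowest weights, via the
symmetric triple): a non-zero `v ∈ V_μ` in the block has `μ = -m + 2 j`. [folklore] -/
lemma exists_weight_eq_neg_add {μ : k} {v : V} (hvW : v ∈ block H E F c) (hv : v ∈ wsp H μ)
    (hv0 : v ≠ 0) : ∃ j : ℕ, μ = -m + 2 * j := by
  have hv' : v ∈ wsp (-H) (-μ) := by rw [mem_wsp_neg_iff, neg_neg]; exact hv
  have hvW' : v ∈ block (-H) F E c := by rw [block, casimir_symm t]; exact hvW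
  obtain ⟨j, hj⟩ := exists_weight_eq_sub t.symm (hdiag_neg hdiag) hcm hvW' hv' hv0
  exact ⟨j, by linear_combination -hj⟩

/-- **The weights of a Casimir block**: a non-zero `v ∈ V_μ` in the block has `μ = m - 2 j` with
`j ≤ m`. [folklore] -/
lemma exists_weight_eq {μ : k} {v : V} (hvW : v ∈ block H E F c) (hv : v ∈ wsp H μ)
    (hv0 : v ≠ 0) : ∃ j : ℕ, j ≤ m ∧ μ = m - 2 * j := by
  obtain ⟨j, hj⟩ := exists_weight_eq_sub t hdiag hcm hvW hv hv0
  obtain ⟨j', hj'⟩ := exists_weight_eq_neg_add t hdiag hcm hvW hv hv0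
  refine ⟨j, ?_, hj⟩
  have h : (2 : k) * m = 2 * (j + j') := by linear_combination hj' - hj
  have h' : (m : k) = j + j' := mul_left_cancel₀ (two_ne_zero' k) h
  have h'' : m = j + j' := by exact_mod_cast h'
  omega

/-- In a Casimir block the weight space `V_{m+2}` is zero. [folklore] -/
lemma eq_zero_of_mem_wsp_add_two {v : V} (hvW : v ∈ block H E F c) (hv : v ∈ wsp H (m + 2)) :
    v = 0 := by
  by_contra hv0
  obtain ⟨j, -, hj⟩ := exists_weight_eq t hdiag hcm hvW hv hv0
  have h : (2 : k) * (j + 1) = 0 := by linear_combination hj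
  rw [mul_eq_zero] at h
  rcases h with h | h
  · exact two_ne_zero h
  · exact Nat.cast_add_one_ne_zero j h

/-- **In a Casimir block, `V_m` consists of primitive vectors.** [folklore] -/
lemma E_eq_zero_of_mem_wsp_m {v : V} (hvW : v ∈ block H E F c) (hv : v ∈ wsp H m) : E v = 0 :=
  eq_zero_of_mem_wsp_add_two t hdiag hcm (apply_E_mem_block t hdiag hvW) (apply_E_mem t hv)

/-- **`F ^ j` is injective on `V_m` within a Casimir block, for `j ≤ m`.** [folklore] -/
lemma eq_zero_of_F_pow_eq_zero {j : ℕ} (hj : j ≤ m) {v : V} (hvW : v ∈ block H E F c)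
    (hv : v ∈ wsp H m) (hF : (F ^ j) v = 0) : v = 0 := by
  by_contra hv0
  exact F_pow_apply_ne_zero t hv hv0 (E_eq_zero_of_mem_wsp_m t hdiag hcm hvW hv) hj hF

omit hdiag in
/-- **`E ^ j` is injective on `V_{m - 2j}` within a Casimir block, for `1 ≤ j`** (each step
`V_{m-2i} → V_{m-2i+2}`, `i ≥ 1`, is injective by `eq_zero_of_E_eq_zero`). [folklore] -/
lemma eq_zero_of_E_pow_eq_zero (hdiag : ⨆ μ : k, wsp H μ = ⊤) :
    ∀ (j : ℕ) {v : V}, v ∈ block H E F c → v ∈ wsp H (m - 2 * (j + 1 : ℕ)) →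
      (E ^ (j + 1)) v = 0 → v = 0 := by
  intro j
  induction j with
  | zero =>
    intro v hvW hv hE
    rw [zero_add, pow_one] at hE
    refine eq_zero_of_E_eq_zero t hcm (fun h => ?_) hvW hv hE
    have h' : (2 : k) * 1 = 0 := by
      have := h
      push_cast at this
      linear_combination -this
    norm_num at h'
  | succ j ih =>
    intro v hvW hv hE
    rw [pow_succ, Module.End.mul_apply] at hE
    have hEv : E v ∈ wsp H (m - 2 * (j + 1 : ℕ)) := by
      have h := apply_E_mem t hv
      convert h using 2
      push_cast
      ring
    have h0 : E v = 0 := ih (apply_E_mem_block t hdiag hvW) hEv hE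
    refine eq_zero_of_E_eq_zero t hcm (fun h => ?_) hvW hv h0
    have h' : (2 : k) * (j + 2) = 0 := by
      have := h
      push_cast at this
      linear_combination -this
    rw [mul_eq_zero] at h'
    rcases h' with h' | h'
    · exact two_ne_zero h'
    · exact Nat.cast_add_one_ne_zero (j + 1) (by push_cast; linear_combination h')

end Symmetric

/-! ### The structure of a Casimir block: `V(c) = ⊕_{j ≤ m} F^j (V(c)_m)` -/

/-- The weight piece `V(c) ∩ V_{m - 2j}` of a Casimir block. [folklore] -/
abbrev piece (H E F : Module.End k V) (c : k) (m j : ℕ) : Submodule k V :=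
  block H E F c ⊓ wsp H ((m : k) - 2 * j)

section BlockStructure

variable [CharZero k] [FiniteDimensional k V] (t : IsSl2Triple H E F)
  (hdiag : ⨆ μ : k, wsp H μ = ⊤) {c : k} {m : ℕ} (hcm : (m : k) * m + 2 * m = c)
include t hdiag

omit [CharZero k] [FiniteDimensional k V] in
/-- `F ^ j` maps the top piece into the `j`-th piece. [folklore] -/
lemma F_pow_mem_piece (j : ℕ) {v : V} (hv : v ∈ piece H E F c m 0) :
    (F ^ j) v ∈ piece H E F c m j := by
  refine ⟨apply_F_pow_mem_block t hdiag hv.1 j, ?_⟩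
  have h := apply_F_pow_mem t hv.2 j
  simpa using h

omit [CharZero k] [FiniteDimensional k V] in
/-- `E ^ j` maps the `j`-th piece into the top piece. [folklore] -/
lemma E_pow_mem_piece (j : ℕ) {v : V} (hv : v ∈ piece H E F c m j) :
    (E ^ j) v ∈ piece H E F c m 0 := by
  refine ⟨apply_E_pow_mem_block t hdiag hv.1 j, ?_⟩
  have h := apply_E_pow_mem t hv.2 j
  simpa using h

omit [CharZero k] [FiniteDimensional k V] in
/-- `F ^ j` restricted to the top piece. [folklore] -/
def Fpow (j : ℕ) : ↥(piece H E F c m 0) →ₗ[k] ↥(piece H E F c m j) :=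
  (F ^ j).restrict fun _ hv => F_pow_mem_piece t hdiag j hv

omit [CharZero k] [FiniteDimensional k V] in
/-- `E ^ j` restricted to the `j`-th piece. [folklore] -/
def Epow (j : ℕ) : ↥(piece H E F c m j) →ₗ[k] ↥(piece H E F c m 0) :=
  (E ^ j).restrict fun _ hv => E_pow_mem_piece t hdiag j hv

include hcm

/-- `Fpow j` is injective for `j ≤ m`. [folklore] -/
lemma Fpow_injective {j : ℕ} (hj : j ≤ m) :
    Function.Injective (Fpow t hdiag (c := c) (m := m) j) := by
  rw [injective_iff_map_eq_zero]
  rintro ⟨v, hv⟩ h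
  have h' : (F ^ j) v = 0 := congrArg Subtype.val h
  have hv2 : v ∈ wsp H m := by simpa using hv.2
  exact Subtype.ext (eq_zero_of_F_pow_eq_zero t hdiag hcm hj hv.1 hv2 h')

/-- `Epow j` is injective. [folklore] -/
lemma Epow_injective (j : ℕ) : Function.Injective (Epow t hdiag (c := c) (m := m) j) := by
  rw [injective_iff_map_eq_zero]
  rintro ⟨v, hv⟩ h
  have h' : (E ^ j) v = 0 := congrArg Subtype.val h
  apply Subtype.ext
  cases j with
  | zero => simpa using h'
  | succ j => exact eq_zero_of_E_pow_eq_zero t hcm hdiag j hv.1 hv.2 h'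

/-- **All pieces of a Casimir block have the same dimension as the top piece** (`j ≤ m`).
[folklore] -/
lemma finrank_piece_eq {j : ℕ} (hj : j ≤ m) :
    Module.finrank k ↥(piece H E F c m j) = Module.finrank k ↥(piece H E F c m 0) :=
  le_antisymm (LinearMap.finrank_le_finrank_of_injective (Epow_injective t hdiag hcm j))
    (LinearMap.finrank_le_finrank_of_injective (Fpow_injective t hdiag hcm hj))

/-- **`F ^ j` maps the top piece onto the `j`-th piece** (`j ≤ m`). [folklore] -/
lemma exists_F_pow_eq {j : ℕ} (hj : j ≤ m) {w : V} (hw : w ∈ piece H E F c m j) :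
    ∃ v ∈ piece H E F c m 0, (F ^ j) v = w := by
  have hsurj : Function.Surjective (Fpow t hdiag (c := c) (m := m) j) :=
    (LinearMap.injective_iff_surjective_of_finrank_eq_finrank
      (finrank_piece_eq t hdiag hcm hj).symm).mp (Fpow_injective t hdiag hcm hj)
  obtain ⟨⟨v, hv⟩, hvw⟩ := hsurj ⟨w, hw⟩
  exact ⟨v, hv, congrArg Subtype.val hvw⟩

/-- **A Casimir block is the sum of its pieces `V(c) ∩ V_{m-2j}`, `j ≤ m`.** [folklore] -/
lemma block_eq_iSup_piece : block H E F c = ⨆ j : Fin (m + 1), piece H E F c m j := by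
  refine le_antisymm ?_ (iSup_le fun j => inf_le_left)
  -- `V(c) = ⊕_μ V(c) ∩ V_μ` since `H` preserves `V(c)`
  have hdec : block H E F c = ⨆ μ : k, block H E F c ⊓ wsp H μ := by
    have h := Submodule.inf_iSup_genEigenspace (p := block H E F c) (f := H)
      (fun v hv => apply_H_mem_block t hdiag hv) 1
    rw [show (⨆ μ : k, H.genEigenspace μ 1) = ⊤ from hdiag, inf_top_eq] at h
    exact h
  conv_lhs => rw [hdec]
  refine iSup_le fun μ => ?_
  by_cases hbot : block H E F c ⊓ wsp H μ = ⊥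
  · rw [hbot]
    exact bot_le
  · obtain ⟨v, hv, hv0⟩ := (Submodule.ne_bot_iff _).mp hbot
    obtain ⟨j, hj, rfl⟩ := exists_weight_eq t hdiag hcm hv.1 hv.2 hv0
    exact le_iSup_of_le (⟨j, Nat.lt_succ_of_le hj⟩ : Fin (m + 1)) le_rfl

end BlockStructure

/-! ### The simultaneous decomposition under `(C, H)` -/

section Decomposition

/-- If the eigenspaces of `H` span, its generalised eigenspaces are eigenspaces. [folklore] -/
lemma maxGenEigenspace_eq_wsp (hdiag : ⨆ μ : k, wsp H μ = ⊤) (μ : k) :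
    H.maxGenEigenspace μ = wsp H μ := by
  refine le_antisymm (fun x hx => ?_) Module.End.eigenspace_le_maxGenEigenspace
  have hx' : x ∈ ⨆ ν : k, wsp H ν := by rw [hdiag]; trivial
  rw [iSup_split_single _ μ, Submodule.mem_sup] at hx'
  obtain ⟨a, ha, b, hb, rfl⟩ := hx'
  have hb' : b ∈ ⨆ (ν : k) (_ : ν ≠ μ), H.maxGenEigenspace ν :=
    (iSup₂_mono fun ν _ => (Module.End.eigenspace_le_maxGenEigenspace (f := H) (μ := ν))) hb
  have hbμ : b ∈ H.maxGenEigenspace μ := by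
    have h := sub_mem hx (Module.End.eigenspace_le_maxGenEigenspace ha)
    rwa [add_sub_cancel_left] at h
  have hb0 : b = 0 :=
    (Submodule.disjoint_def.mp (Module.End.independent_maxGenEigenspace H μ)) b hbμ hb'
  rw [hb0, add_zero]
  exact ha

/-- The commuting pair `(C, H)`. [folklore] -/
def pairCH (H E F : Module.End k V) : Bool → Module.End k V :=
  fun b => if b then casimir H E F else H

/-- The simultaneous piece `V(c) ∩ V_μ` of the pair `(C, H)` attached to `χ = (c, μ)`.
[folklore] -/
abbrev simPiece (H E F : Module.End k V) (χ : Bool → k) : Submodule k V :=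
  block H E F (χ true) ⊓ wsp H (χ false)

/-- The simultaneous generalised eigenspaces of `(C, H)` are the `V(c) ∩ V_μ`. [folklore] -/
lemma iInf_maxGenEigenspace_pairCH (hdiag : ⨆ μ : k, wsp H μ = ⊤) (χ : Bool → k) :
    (⨅ b, (pairCH H E F b).maxGenEigenspace (χ b)) = simPiece H E F χ := by
  rw [iInf_bool_eq]
  simp only [pairCH, if_true, Bool.false_eq_true, if_false, maxGenEigenspace_eq_wsp hdiag]

variable [FiniteDimensional k V] (t : IsSl2Triple H E F) (hdiag : ⨆ μ : k, wsp H μ = ⊤)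
include t hdiag

omit [FiniteDimensional k V] in
/-- The simultaneous pieces are independent. [folklore] -/
lemma iSupIndep_simPiece : iSupIndep (simPiece H E F) := by
  have hcomm : ∀ i j : Bool, Commute (pairCH H E F i) (pairCH H E F j) := by
    intro i j
    cases i <;> cases j
    · exact Commute.refl _
    · exact (commute_casimir_H t hdiag).symm
    · exact commute_casimir_H t hdiag
    · exact Commute.refl _
  have h := Module.End.independent_iInf_maxGenEigenspace_of_forall_mapsTo (pairCH H E F)
    fun i j φ => Module.End.mapsTo_maxGenEigenspace_of_comm (hcomm j i) φ
  simpa only [iInf_maxGenEigenspace_pairCH hdiag] using h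

/-- The simultaneous pieces span (over an algebraically closed field). [folklore] -/
lemma iSup_simPiece_eq_top [IsAlgClosed k] : ⨆ χ : Bool → k, simPiece H E F χ = ⊤ := by
  have hcomm : Pairwise fun i j : Bool => Commute (pairCH H E F i) (pairCH H E F j) := by
    intro i j _
    cases i <;> cases j
    · exact Commute.refl _
    · exact (commute_casimir_H t hdiag).symm
    · exact commute_casimir_H t hdiag
    · exact Commute.refl _
  have h := Module.End.iSup_iInf_maxGenEigenspace_eq_top_of_iSup_maxGenEigenspace_eq_top_of_commute
    (pairCH H E F) hcomm fun i => Module.End.iSup_maxGenEigenspace_eq_top _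
  simpa only [iInf_maxGenEigenspace_pairCH hdiag] using h

/-- There are finitely many non-zero simultaneous pieces. [folklore] -/
lemma finite_simPiece_ne_bot : Finite {χ : Bool → k // simPiece H E F χ ≠ ⊥} :=
  let _ := (iSupIndep_simPiece t hdiag).fintypeNeBotOfFiniteDimensional
  Finite.of_fintype _

/-- The non-zero simultaneous pieces, as a finite type (for indexing matrices). [folklore] -/
@[reducible] def fintypeSimPieceNeBot : Fintype {χ : Bool → k // simPiece H E F χ ≠ ⊥} :=
  (iSupIndep_simPiece t hdiag).fintypeNeBotOfFiniteDimensional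

/-- **`V` is the internal direct sum of the non-zero pieces `V(c) ∩ V_μ`.** [folklore] -/
lemma isInternal_simPiece [IsAlgClosed k] [DecidableEq (Bool → k)] :
    DirectSum.IsInternal fun χ : {χ : Bool → k // simPiece H E F χ ≠ ⊥} => simPiece H E F χ.1 := by
  rw [DirectSum.isInternal_ne_bot_iff, DirectSum.isInternal_submodule_iff_iSupIndep_and_iSup_eq_top]
  exact ⟨iSupIndep_simPiece t hdiag, iSup_simPiece_eq_top t hdiag⟩

end Decomposition

/-! ### The string basis -/

section StringBasis

variable [CharZero k] [FiniteDimensional k V] (t : IsSl2Triple H E F)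
  (hdiag : ⨆ μ : k, wsp H μ = ⊤)
include t hdiag

/-- Every non-zero Casimir block has an `m : ℕ` with `c = m (m + 2)` (the common weight of its
primitive vectors). [folklore] -/
lemma exists_nat_of_block_ne_bot {c : k} (hc : block H E F c ≠ ⊥) :
    ∃ m : ℕ, (m : k) * m + 2 * m = c := by
  -- a non-zero weight vector of the block
  have hdec : block H E F c = ⨆ μ : k, block H E F c ⊓ wsp H μ := by
    have h := Submodule.inf_iSup_genEigenspace (p := block H E F c) (f := H)
      (fun v hv => apply_H_mem_block t hdiag hv) 1
    rw [show (⨆ μ : k, H.genEigenspace μ 1) = ⊤ from hdiag, inf_top_eq] at h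
    exact h
  have hex : ∃ μ : k, block H E F c ⊓ wsp H μ ≠ ⊥ := by
    by_contra hall
    push Not at hall
    apply hc
    rw [hdec]
    simp [hall]
  obtain ⟨μ, hμ⟩ := hex
  obtain ⟨v, hv, hv0⟩ := (Submodule.ne_bot_iff _).mp hμ
  obtain ⟨j, hj0, hjE⟩ := exists_E_pow_primitive t hv.2 hv0
  obtain ⟨m, hm⟩ := exists_nat_of_primitive t (apply_E_pow_mem t hv.2 j) hj0 hjE
  refine ⟨m, ?_⟩
  have h := casimir_scalar_eq_of_primitive (apply_E_pow_mem_block t hdiag hv.1 j)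
    (apply_E_pow_mem t hv.2 j) hj0 hjE
  rwa [hm] at h

omit [FiniteDimensional k V] t hdiag in
/-- The natural number `m (c)` with `c = m (m + 2)` if there is one (else `0`). [folklore] -/
def natOf (c : k) : ℕ :=
  by classical exact if h : ∃ m : ℕ, (m : k) * m + 2 * m = c then Classical.choose h else 0

omit [CharZero k] [FiniteDimensional k V] t hdiag in
/-- `natOf c` satisfies `c = m (m + 2)` whenever some `m` does. [folklore] -/
lemma natOf_spec {c : k} (h : ∃ m : ℕ, (m : k) * m + 2 * m = c) :
    (natOf c : k) * natOf c + 2 * natOf c = c := by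
  classical
  rw [natOf, dif_pos h]
  exact Classical.choose_spec h

/-- The non-zero simultaneous pieces. [folklore] -/
abbrev NE (H E F : Module.End k V) : Type _ := {χ : Bool → k // simPiece H E F χ ≠ ⊥}

omit [CharZero k] [FiniteDimensional k V] t hdiag in
/-- A non-zero piece has a non-zero block. [folklore] -/
lemma block_ne_bot_of_NE (χ : NE H E F) : block H E F (χ.1 true) ≠ ⊥ :=
  fun h => χ.2 (by rw [simPiece, h, bot_inf_eq])

/-- `c = m (m + 2)` for the block of a non-zero piece, `m = natOf c`. [folklore] -/
lemma natOf_spec_NE (χ : NE H E F) :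
    (natOf (χ.1 true) : k) * natOf (χ.1 true) + 2 * natOf (χ.1 true) = χ.1 true :=
  natOf_spec (exists_nat_of_block_ne_bot t hdiag (block_ne_bot_of_NE χ))

/-- The position `j ≤ m` of a non-zero piece: its weight is `m - 2 j`. [folklore] -/
lemma exists_pos (χ : NE H E F) :
    ∃ j : ℕ, j ≤ natOf (χ.1 true) ∧ χ.1 false = natOf (χ.1 true) - 2 * j := by
  obtain ⟨v, hv, hv0⟩ := (Submodule.ne_bot_iff _).mp χ.2
  exact exists_weight_eq t hdiag (natOf_spec_NE t hdiag χ) hv.1 hv.2 hv0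

/-- The position of a non-zero piece in its string. [folklore] -/
def posOf (χ : NE H E F) : ℕ := Classical.choose (exists_pos t hdiag χ)

/-- `posOf χ ≤ m`. [folklore] -/
lemma posOf_le (χ : NE H E F) : posOf t hdiag χ ≤ natOf (χ.1 true) :=
  (Classical.choose_spec (exists_pos t hdiag χ)).1

/-- The weight of the piece `χ` is `m - 2 posOf χ`. [folklore] -/
lemma weight_eq_posOf (χ : NE H E F) :
    χ.1 false = natOf (χ.1 true) - 2 * (posOf t hdiag χ) :=
  (Classical.choose_spec (exists_pos t hdiag χ)).2

/-- A non-zero piece is the `posOf`-th piece of its block. [folklore] -/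
lemma simPiece_eq_piece (χ : NE H E F) :
    simPiece H E F χ.1 = piece H E F (χ.1 true) (natOf (χ.1 true)) (posOf t hdiag χ) := by
  rw [simPiece, piece, weight_eq_posOf t hdiag χ]

/-- The top piece `V(c) ∩ V_m` of the block `c`. [folklore] -/
abbrev topPiece (H E F : Module.End k V) (c : k) : Submodule k V := piece H E F c (natOf c) 0

omit [CharZero k] t hdiag in
/-- A basis of the top piece of the block `c`. [folklore] -/
def topBasis (c : k) : Basis (Fin (Module.finrank k ↥(topPiece H E F c))) k ↥(topPiece H E F c) :=
  Module.finBasis k _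

/-- **The string equivalence `F ^ j : V(c) ∩ V_m ≃ V(c) ∩ V_{m - 2j}`** onto a non-zero piece.
[folklore] -/
def stringEquiv (χ : NE H E F) : ↥(topPiece H E F (χ.1 true)) ≃ₗ[k] ↥(simPiece H E F χ.1) :=
  (LinearEquiv.ofBijective (Fpow t hdiag (c := χ.1 true) (m := natOf (χ.1 true)) (posOf t hdiag χ))
    ⟨Fpow_injective t hdiag (natOf_spec_NE t hdiag χ) (posOf_le t hdiag χ),
      (LinearMap.injective_iff_surjective_of_finrank_eq_finrank
        (finrank_piece_eq t hdiag (natOf_spec_NE t hdiag χ) (posOf_le t hdiag χ)).symm).mp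
        (Fpow_injective t hdiag (natOf_spec_NE t hdiag χ) (posOf_le t hdiag χ))⟩).trans
    (LinearEquiv.ofEq _ _ (simPiece_eq_piece t hdiag χ).symm)

/-- The string equivalence is `F ^ j`. [folklore] -/
lemma coe_stringEquiv_apply (χ : NE H E F) (v : ↥(topPiece H E F (χ.1 true))) :
    (stringEquiv t hdiag χ v : V) = (F ^ posOf t hdiag χ) (v : V) := rfl

/-- The basis `F ^ j (top basis)` of a non-zero piece. [folklore] -/
def pieceBasis (χ : NE H E F) :
    Basis (Fin (Module.finrank k ↥(topPiece H E F (χ.1 true)))) k ↥(simPiece H E F χ.1) :=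
  (topBasis (χ.1 true)).map (stringEquiv t hdiag χ)

variable [IsAlgClosed k] [DecidableEq (Bool → k)]

/-- **The string basis of `V`**: the union over the non-zero pieces `V(c) ∩ V_{m-2j}` of the
families `F ^ j (w)`, `w` running over a basis of the top piece `V(c) ∩ V_m` (primitive
vectors of weight `m`). [folklore] -/
def stringBasis : Basis (Σ χ : NE H E F, Fin (Module.finrank k ↥(topPiece H E F (χ.1 true)))) k V :=
  (isInternal_simPiece t hdiag).collectedBasis (pieceBasis t hdiag)

/-- The string basis vectors are `F ^ j (w)`. [folklore] -/
lemma stringBasis_apply (χ : NE H E F) (s : Fin (Module.finrank k ↥(topPiece H E F (χ.1 true)))) :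
    stringBasis t hdiag ⟨χ, s⟩ =
      (F ^ posOf t hdiag χ) ((topBasis (χ.1 true) s : ↥(topPiece H E F (χ.1 true))) : V) := by
  rw [stringBasis, DirectSum.IsInternal.collectedBasis_coe]
  simp only [pieceBasis, Module.Basis.map_apply, coe_stringEquiv_apply]

omit [IsAlgClosed k] [DecidableEq (Bool → k)] in
/-- **The heads of the strings are primitive vectors of weight `m`.** [folklore] -/
lemma topBasis_primitive (c : k) (hc : ∃ m : ℕ, (m : k) * m + 2 * m = c)
    (s : Fin (Module.finrank k ↥(topPiece H E F c))) :
    H ((topBasis c s : ↥(topPiece H E F c)) : V) =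
        (natOf c : k) • ((topBasis c s : ↥(topPiece H E F c)) : V) ∧
      E ((topBasis c s : ↥(topPiece H E F c)) : V) = 0 := by
  have hmem := (topBasis c s : ↥(topPiece H E F c)).2
  have hw : ((topBasis c s : ↥(topPiece H E F c)) : V) ∈ wsp H (natOf c) := by
    have h := hmem.2
    simpa using h
  exact ⟨mem_wsp_iff.mp hw, E_eq_zero_of_mem_wsp_m t hdiag (natOf_spec hc) hmem.1 hw⟩

omit [IsAlgClosed k] [DecidableEq (Bool → k)] in
/-- **Every position `j ≤ m` of a non-zero block is a non-zero piece**: `V(c) ∩ V_{m - 2j} ≠ 0`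
(it has the dimension of the top piece, which contains a primitive vector). [folklore] -/
lemma simPiece_ne_bot_of_le {c : k} (hc : block H E F c ≠ ⊥) {j : ℕ} (hj : j ≤ natOf c) :
    simPiece H E F (fun b => if b then c else (natOf c : k) - 2 * j) ≠ ⊥ := by
  have hcm := natOf_spec (exists_nat_of_block_ne_bot t hdiag hc)
  -- the top piece is non-zero: it contains a primitive vector
  have htop : topPiece H E F c ≠ ⊥ := by
    have hdec : block H E F c = ⨆ μ : k, block H E F c ⊓ wsp H μ := by
      have h := Submodule.inf_iSup_genEigenspace (p := block H E F c) (f := H)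
        (fun v hv => apply_H_mem_block t hdiag hv) 1
      rw [show (⨆ μ : k, H.genEigenspace μ 1) = ⊤ from hdiag, inf_top_eq] at h
      exact h
    have hex : ∃ μ : k, block H E F c ⊓ wsp H μ ≠ ⊥ := by
      by_contra hall
      push Not at hall
      apply hc
      rw [hdec]
      simp [hall]
    obtain ⟨μ, hμ⟩ := hex
    obtain ⟨v, hv, hv0⟩ := (Submodule.ne_bot_iff _).mp hμ
    obtain ⟨i, hi0, hiE⟩ := exists_E_pow_primitive t hv.2 hv0
    have hm := weight_eq_of_primitive t hcm (apply_E_pow_mem_block t hdiag hv.1 i)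
      (apply_E_pow_mem t hv.2 i) hi0 hiE
    refine (Submodule.ne_bot_iff _).mpr ⟨(E ^ i) v, ⟨apply_E_pow_mem_block t hdiag hv.1 i, ?_⟩, hi0⟩
    have h := apply_E_pow_mem t hv.2 i
    rw [hm] at h
    simpa using h
  -- dimension of the `j`-th piece
  intro hbot
  have hfin := finrank_piece_eq t hdiag hcm hj
  have hpiece : piece H E F c (natOf c) j = ⊥ := by
    have : simPiece H E F (fun b => if b then c else (natOf c : k) - 2 * j) =
        piece H E F c (natOf c) j := by simp [simPiece, piece]
    rw [← this]
    exact hbot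
  rw [hpiece, finrank_bot] at hfin
  exact htop (Submodule.finrank_eq_zero.mp hfin.symm)

omit [IsAlgClosed k] [DecidableEq (Bool → k)] in
/-- The position of the piece `(c, m - 2j)` is `j`. [folklore] -/
lemma posOf_eq {c : k} (hc : block H E F c ≠ ⊥) {j : ℕ} (hj : j ≤ natOf c) :
    posOf t hdiag ⟨fun b => if b then c else (natOf c : k) - 2 * j,
      simPiece_ne_bot_of_le t hdiag hc hj⟩ = j := by
  have h := weight_eq_posOf t hdiag ⟨fun b => if b then c else (natOf c : k) - 2 * j,
    simPiece_ne_bot_of_le t hdiag hc hj⟩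
  simp only [Bool.false_eq_true, if_false, if_true] at h
  have h2 : (2 : k) * j = 2 * (posOf t hdiag ⟨fun b => if b then c else (natOf c : k) - 2 * j,
      simPiece_ne_bot_of_le t hdiag hc hj⟩ : ℕ) := by linear_combination -h
  exact_mod_cast (mul_left_cancel₀ (two_ne_zero' k) h2).symm

end StringBasis

end Literature.Algebra.Lie.Sl2
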